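import Literature.Geometry.Symplectic.OrigamiNullFoliation
import Literature.Geometry.Kaehler.ManifoldFormsPullback
import Literature.Topology.FourManifolds.RegularLevelCollar
import HarnessLib

/-!
# The product collar of the fold along a unit field, and the pulled-back form on it

Proofs companion of `OrigamiUnfolding.lean` (the named fact
`Literature.Geometry.Symplectic.exists_symplecticCutPieces_of_isOrigamiForm`, Cannas da
Silva–Guillemin–Pires, *Symplectic Origami*, IMRN 2011 = arXiv:0909.4065, Prop. 2.8; architecture
in `OrigamiUnfoldingProofs.lean`, steps (S0)–(S4)), step (S1a): the COLLAR of the fold.  The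
printed proof of Prop. 2.8 works in a Moser model `φ : Z × (-ε, ε) → 𝒰` of the fold (Cannas da
Silva–Guillemin–Woodward 2000, Thm. 1), which starts from a product neighbourhood of `Z` whose
normal direction along `Z` lies in `ker ω`.  With the defining function `f` of the fold
(`OrigamiFoldDefiningFunction.lean`: `Z = f⁻¹(0)` regular) and a unit field `U` across a band of
it (`Topology/FourManifolds/RegularLevelCollar.lean`: `U.ξ(f) = 1` on `f⁻¹[-δ, δ]`, global flow
`U.fl`; kernel-adapted ones exist by `OrigamiFoldKernelField.lean`), the collar is the flow-out
of the folding hypersurface `j : N ↪ M`: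

* `foldCollar U j (n, t) = U.fl (j n) t` — Milnor's `h(y, s) = ψ_y(s)` (proof of Thm. 3.4 of
  the h-cobordism lectures) precomposed with `j`; `foldCollar_zero` (`c(n,0) = j n`),
  `apply_foldCollar` (the clock `f (c(n,t)) = t`, `|t| < δ`), `injOn_foldCollar`
  (injective on `N × (-δ, δ)` for injective `j` into the zero level), `image_foldCollar` (onto
  the band `f⁻¹(-δ, δ)` when `range j = f⁻¹(0)`), `contMDiff_foldCollar` (`C^∞` on `N × ℝ`,
  product model `(𝓡 3).prod 𝓘(ℝ, ℝ)`);
* the differential: `mfderiv_foldCollar_inr` (`dc (0, 1) = ξ ∘ c`: flow lines are integral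
  curves), `mfderiv_foldCollar_inl` (`dc (v, 0) = d(Fl_t) (dj v)`),
  `mfderiv_apply_mfderiv_foldCollar` (`df ∘ dc = dt` on the band), `injective_mfderiv_fl`
  (`Fl_{-t} ∘ Fl_t = id`), **`injective_mfderiv_foldCollar`** / `bijective_mfderiv_foldCollar`
  — on `N × (-δ, δ)` the collar map of an embedded hypersurface in the zero level is a local
  diffeomorphism (with `injOn_foldCollar`: a diffeomorphism onto the open band);
* the pulled-back form `c^*ω` (`MForm.pullback`, `ManifoldFormsPullback.lean`):
  `isSmoothForm_pullback_foldCollar`, `isClosedForm_pullback_foldCollar` (naturality of `d`),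
  `pullback_foldCollar_nondegenerate` (non-degenerate at `(n, t)` for `0 < |t| < δ`: the point
  `c(n,t)` is off the fold `f⁻¹(0)` and `dc` is bijective), and along the zero section
  **`pullback_foldCollar_apply_inl_inl`** (`(c^*ω)_{(n,0)}((v,0),(v',0)) = (j^*ω)_n(v,v')`) and
  **`pullback_foldCollar_apply_inr`** (`(c^*ω)_{(n,0)}((0,1), ·) = 0` when `U.ξ ∈ ker ω` along
  `j`): for a kernel-adapted unit field, **`c^*ω` restricted to `N × {0}` is `pr^* j^*ω` with no
  `dt`-component** — the zeroth-order term of the Moser model `p^* i^*ω + d(t² p^*α)` of the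
  proof of Prop. 2.8, from which step (S1) proceeds (first-order coefficient, rescaling,
  normalisation).

Everything here is proved; the only definition is the collar map `foldCollar`; no named facts
(D-0026).

## References

* [CannasdasilvaGuilleminPires2010] A. Cannas da Silva, V. Guillemin, A. R. Pires, *Symplectic
  Origami*, IMRN 2011, 4252–4293 = arXiv:0909.4065, §2.1, Prop. 2.8 and its proof (Moser model).
* A. Cannas da Silva, V. Guillemin, C. Woodward, *On the unfolding of folded symplectic
  structures*, Math. Res. Lett. 7 (2000) 35–53, Thm. 1.
* J. Milnor, *Lectures on the h-cobordism theorem* (1965), proof of Thm. 3.4 (the product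
  neighbourhood of a regular level by flowing a unit field). [MilnorHCobordism1965]
* J. M. Lee, *Introduction to Smooth Manifolds*, 2nd ed. (2012), Thm. 9.12 (flows).
  [LeeSmoothManifolds2013]
-/

noncomputable section

open scoped Manifold ContDiff Topology
open Set Function Filter
open Literature.Geometry.Kaehler Literature.Topology.FourManifolds

namespace Literature.Geometry.Symplectic

universe u

variable {M : Type u} [TopologicalSpace M] [T2Space M] [CompactSpace M]
  [ChartedSpace (EuclideanSpace ℝ (Fin 4)) M] [IsManifold (𝓡 4) ∞ M]
variable {N : Type}

/-- **The collar map of a map `j : N → M` along a unit field** `U` of a function `f` (level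
`0`): the flow-out `(n, t) ↦ Fl^ξ_t (j n)` (Milnor's `h(y, s) = ψ_y(s)`, proof of Thm. 3.4 of
the h-cobordism lectures, precomposed with `j`). For the fold `j` of a folded form, `f` its
defining function and `U` kernel-adapted, this is the collar of step (S1) of the unfolding.
[cite: MilnorHCobordism1965, proof of Thm. 3.4] -/
def foldCollar {f : M → ℝ} (U : LevelUnitField 3 f 0) (j : N → M) : N × ℝ → M :=
  fun p => U.fl (j p.1) p.2

section SetTheory

variable {f : M → ℝ} (U : LevelUnitField 3 f 0) {j : N → M}

/-- Unfolding the collar map. [folklore] -/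
theorem foldCollar_apply (j : N → M) (n : N) (t : ℝ) : foldCollar U j (n, t) = U.fl (j n) t := rfl

/-- The collar starts on the hypersurface: `c(n, 0) = j n`. [cite: MilnorHCobordism1965, proof of Thm. 3.4] -/
@[simp] theorem foldCollar_zero (j : N → M) (n : N) : foldCollar U j (n, 0) = j n := by
  rw [foldCollar_apply, U.fl_zero]

/-- **The clock**: `f (c(n, t)) = t` for `|t| < δ` when `j` maps into the zero level.
[cite: MilnorHCobordism1965, proof of Thm. 3.4] -/
theorem apply_foldCollar (hj0 : ∀ n, f (j n) = 0) (n : N) {t : ℝ} (ht : t ∈ Ioo (-U.δ) U.δ) :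
    f (foldCollar U j (n, t)) = t := by
  rw [foldCollar_apply, U.apply_fl_of_apply_eq (hj0 n) ht, zero_add]

/-- **The collar map is injective on `N × (-δ, δ)`** (for injective `j` into the zero level).
[cite: MilnorHCobordism1965, proof of Thm. 3.4] -/
theorem injOn_foldCollar (hj0 : ∀ n, f (j n) = 0) (hj : Injective j) :
    InjOn (foldCollar U j) (univ ×ˢ Ioo (-U.δ) U.δ) := by
  rintro ⟨n, t⟩ ⟨-, ht⟩ ⟨n', t'⟩ ⟨-, ht'⟩ heq
  have h := U.fl_injOn (a := 0)
    (show ((j n, t) : M × ℝ) ∈ (f ⁻¹' {0}) ×ˢ Ioo (-U.δ) U.δ from ⟨hj0 n, ht⟩)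
    (show ((j n', t') : M × ℝ) ∈ (f ⁻¹' {0}) ×ˢ Ioo (-U.δ) U.δ from ⟨hj0 n', ht'⟩) heq
  simp only [Prod.mk.injEq] at h
  rw [hj h.1, h.2]

/-- **The image of `N × (-δ, δ)` is the open band `f⁻¹(-δ, δ)`** when `j` maps ONTO the zero
level. [cite: MilnorHCobordism1965, proof of Thm. 3.4] -/
theorem image_foldCollar (hj0 : range j = f ⁻¹' {0}) :
    foldCollar U j '' (univ ×ˢ Ioo (-U.δ) U.δ) = f ⁻¹' Ioo (-U.δ) U.δ := by
  have h := U.image_fl_eq_band (a := 0)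
  rw [LevelUnitField.band, zero_sub, zero_add] at h
  rw [← h]
  ext x
  constructor
  · rintro ⟨⟨n, t⟩, ⟨-, ht⟩, rfl⟩
    exact ⟨(j n, t), ⟨hj0 ▸ mem_range_self n, ht⟩, rfl⟩
  · rintro ⟨⟨y, t⟩, ⟨hy, ht⟩, rfl⟩
    obtain ⟨n, rfl⟩ : y ∈ range j := hj0 ▸ hy
    exact ⟨(n, t), ⟨mem_univ n, ht⟩, rfl⟩

/-- The differential of the time-`t` map of the flow is injective (`Fl_{-t} ∘ Fl_t = id`).
[cite: LeeSmoothManifolds2013, Thm. 9.12] -/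
theorem injective_mfderiv_fl (x : M) (t : ℝ) :
    Injective (mfderiv (𝓡 4) (𝓡 4) (fun y => U.fl y t) x) := by
  have h1 : MDifferentiableAt (𝓡 4) (𝓡 4) (fun y => U.fl y t) x :=
    (U.contMDiff_fl_apply t).mdifferentiableAt (by norm_num)
  have h2 : MDifferentiableAt (𝓡 4) (𝓡 4) (fun y => U.fl y (-t)) (U.fl x t) :=
    (U.contMDiff_fl_apply (-t)).mdifferentiableAt (by norm_num)
  have hcomp := mfderiv_comp x h2 h1
  have hid : (fun y => U.fl y (-t)) ∘ (fun y => U.fl y t) = id := by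
    funext y
    exact U.fl_neg_fl y t
  rw [hid, mfderiv_id] at hcomp
  intro v w hvw
  have ev : mfderiv (𝓡 4) (𝓡 4) (fun y => U.fl y (-t)) (U.fl x t)
      (mfderiv (𝓡 4) (𝓡 4) (fun y => U.fl y t) x v) = v := (congrArg (fun L => L v) hcomp).symm
  have ew : mfderiv (𝓡 4) (𝓡 4) (fun y => U.fl y (-t)) (U.fl x t)
      (mfderiv (𝓡 4) (𝓡 4) (fun y => U.fl y t) x w) = w := (congrArg (fun L => L w) hcomp).symm
  rw [← ev, ← ew, hvw]

end SetTheory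

section Differential

variable [TopologicalSpace N] [ChartedSpace (EuclideanSpace ℝ (Fin 3)) N]
variable {f : M → ℝ} (U : LevelUnitField 3 f 0) {j : N → M}

/-- The collar map is `C^∞` (joint smoothness of the flow). [cite: LeeSmoothManifolds2013, Thm. 9.12] -/
theorem contMDiff_foldCollar (hj : ContMDiff (𝓡 3) (𝓡 4) ∞ j) :
    ContMDiff ((𝓡 3).prod 𝓘(ℝ, ℝ)) (𝓡 4) ∞ (foldCollar U j) :=
  U.contMDiff_fl.comp ((hj.comp contMDiff_fst).prodMk contMDiff_snd)

/-! ### The differential of the collar map -/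

/-- The `t`-derivative of the collar map is the field: `dc_{(n,t)}(0, 1) = ξ(c(n, t))` (the flow
lines are integral curves). [cite: LeeSmoothManifolds2013, Thm. 9.12] -/
theorem mfderiv_foldCollar_inr (hj : ContMDiff (𝓡 3) (𝓡 4) ∞ j) (n : N) (t : ℝ) :
    mfderiv ((𝓡 3).prod 𝓘(ℝ, ℝ)) (𝓡 4) (foldCollar U j) (n, t)
        ((0 : EuclideanSpace ℝ (Fin 3)), (1 : ℝ)) = U.ξ (foldCollar U j (n, t)) := by
  -- the curve `t ↦ c(n, t)` is the flow line through `j n`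
  have hcurve : HasMFDerivAt 𝓘(ℝ, ℝ) (𝓡 4) (U.fl (j n)) t
      ((1 : ℝ →L[ℝ] ℝ).smulRight (U.ξ (U.fl (j n) t))) :=
    isMIntegralCurve_flow U.contMDiff (j n) t
  -- `t ↦ (n, t)` has derivative `(0, 1)`
  have hι : HasMFDerivAt 𝓘(ℝ, ℝ) ((𝓡 3).prod 𝓘(ℝ, ℝ)) (fun t : ℝ => ((n, t) : N × ℝ)) t
      ((0 : ℝ →L[ℝ] EuclideanSpace ℝ (Fin 3)).prod (ContinuousLinearMap.id ℝ ℝ)) :=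
    (hasMFDerivAt_const n t).prodMk (hasMFDerivAt_id t)
  have hc : MDifferentiableAt ((𝓡 3).prod 𝓘(ℝ, ℝ)) (𝓡 4) (foldCollar U j) (n, t) :=
    (contMDiff_foldCollar U hj).mdifferentiableAt (by norm_num)
  have hcomp := hc.hasMFDerivAt.comp t hι
  -- compare the two derivatives of the same curve
  have heq : foldCollar U j ∘ (fun t : ℝ => ((n, t) : N × ℝ)) = U.fl (j n) := rfl
  rw [heq] at hcomp
  have huniq := hcurve.mfderiv.symm.trans hcomp.mfderiv
  have h1 := congrArg (fun L : ℝ →L[ℝ] TangentSpace (𝓡 4) (U.fl (j n) t) => L 1) huniq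
  have lhs : ((1 : ℝ →L[ℝ] ℝ).smulRight (U.ξ (U.fl (j n) t))) 1 = U.ξ (U.fl (j n) t) := by
    rw [ContinuousLinearMap.smulRight_apply]
    exact one_smul _ _
  have h2 : ((1 : ℝ →L[ℝ] ℝ).smulRight (U.ξ (U.fl (j n) t))) 1 =
      mfderiv ((𝓡 3).prod 𝓘(ℝ, ℝ)) (𝓡 4) (foldCollar U j) (n, t)
        ((0 : EuclideanSpace ℝ (Fin 3)), (1 : ℝ)) := h1
  rw [lhs] at h2
  exact h2.symm

/-- **`df ∘ dc = dt`**: along the collar, `df_{c(n,t)} (dc_{(n,t)} (v, τ)) = τ` for `|t| < δ`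
(differentiate `f ∘ c = pr₂` on the open set `N × (-δ, δ)`). [cite: MilnorHCobordism1965, proof of Thm. 3.4] -/
theorem mfderiv_apply_mfderiv_foldCollar (hj : ContMDiff (𝓡 3) (𝓡 4) ∞ j) (hj0 : ∀ n, f (j n) = 0)
    (n : N) {t : ℝ} (ht : t ∈ Ioo (-U.δ) U.δ) (V : EuclideanSpace ℝ (Fin 3) × ℝ) :
    mfderiv (𝓡 4) 𝓘(ℝ, ℝ) f (foldCollar U j (n, t))
      (mfderiv ((𝓡 3).prod 𝓘(ℝ, ℝ)) (𝓡 4) (foldCollar U j) (n, t) V) = V.2 := by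
  have hc : MDifferentiableAt ((𝓡 3).prod 𝓘(ℝ, ℝ)) (𝓡 4) (foldCollar U j) (n, t) :=
    (contMDiff_foldCollar U hj).mdifferentiableAt (by norm_num)
  have hf : MDifferentiableAt (𝓡 4) 𝓘(ℝ, ℝ) f (foldCollar U j (n, t)) :=
    U.contMDiff_f.mdifferentiableAt (by norm_num)
  have hcomp := (mfderiv_comp (n, t) hf hc).symm
  -- `f ∘ c = Prod.snd` near `(n, t)`
  have hev : f ∘ foldCollar U j =ᶠ[𝓝 ((n, t) : N × ℝ)] Prod.snd := by
    have hopen : IsOpen ((univ : Set N) ×ˢ Ioo (-U.δ) U.δ) := isOpen_univ.prod isOpen_Ioo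
    filter_upwards [hopen.mem_nhds ⟨mem_univ n, ht⟩] with p hp
    exact apply_foldCollar U hj0 p.1 hp.2
  have h2 : mfderiv ((𝓡 3).prod 𝓘(ℝ, ℝ)) 𝓘(ℝ, ℝ) (f ∘ foldCollar U j) (n, t) =
      mfderiv ((𝓡 3).prod 𝓘(ℝ, ℝ)) 𝓘(ℝ, ℝ) (Prod.snd : N × ℝ → ℝ) (n, t) := hev.mfderiv_eq
  rw [h2, mfderiv_snd] at hcomp
  have h3 := congrArg (fun L => L V) hcomp
  exact h3.trans rfl

/-- The `N`-directional derivative of the collar map: `dc_{(n,t)}(v, 0) = d(Fl_t)(dj_n v)`.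
[cite: MilnorHCobordism1965, proof of Thm. 3.4] -/
theorem mfderiv_foldCollar_inl (hj : ContMDiff (𝓡 3) (𝓡 4) ∞ j) (n : N) (t : ℝ)
    (v : EuclideanSpace ℝ (Fin 3)) :
    mfderiv ((𝓡 3).prod 𝓘(ℝ, ℝ)) (𝓡 4) (foldCollar U j) (n, t) (v, (0 : ℝ)) =
      mfderiv (𝓡 4) (𝓡 4) (fun y => U.fl y t) (j n) (mfderiv (𝓡 3) (𝓡 4) j n v) := by
  -- `c ∘ (·, t) = Fl_t ∘ j`
  have hι : HasMFDerivAt (𝓡 3) ((𝓡 3).prod 𝓘(ℝ, ℝ)) (fun m : N => ((m, t) : N × ℝ)) n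
      ((ContinuousLinearMap.id ℝ (EuclideanSpace ℝ (Fin 3))).prod
        (0 : EuclideanSpace ℝ (Fin 3) →L[ℝ] ℝ)) :=
    (hasMFDerivAt_id n).prodMk (hasMFDerivAt_const t n)
  have hc : MDifferentiableAt ((𝓡 3).prod 𝓘(ℝ, ℝ)) (𝓡 4) (foldCollar U j) (n, t) :=
    (contMDiff_foldCollar U hj).mdifferentiableAt (by norm_num)
  have hcomp := hc.hasMFDerivAt.comp n hι
  have heq : foldCollar U j ∘ (fun m : N => ((m, t) : N × ℝ)) = (fun y => U.fl y t) ∘ j := rfl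
  rw [heq] at hcomp
  have hjd : MDifferentiableAt (𝓡 3) (𝓡 4) j n := hj.mdifferentiableAt (by norm_num)
  have hfl : MDifferentiableAt (𝓡 4) (𝓡 4) (fun y => U.fl y t) (j n) :=
    (U.contMDiff_fl_apply t).mdifferentiableAt (by norm_num)
  have h2 := mfderiv_comp n hfl hjd
  have huniq := hcomp.mfderiv
  rw [h2] at huniq
  have h3 := congrArg (fun L => L v) huniq
  exact h3.symm

/-- **The differential of the collar map is injective** on `N × (-δ, δ)` (for an immersion `j`
into the zero level): `df ∘ dc = dt` kills the `t`-component, and on `N`-vectors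
`dc = d(Fl_t) ∘ dj` is injective. [cite: MilnorHCobordism1965, proof of Thm. 3.4] -/
theorem injective_mfderiv_foldCollar [IsManifold (𝓡 3) ∞ N]
    (hj : Manifold.IsSmoothEmbedding (𝓡 3) (𝓡 4) ∞ j)
    (hj0 : ∀ n, f (j n) = 0) (n : N) {t : ℝ} (ht : t ∈ Ioo (-U.δ) U.δ) :
    Injective (mfderiv ((𝓡 3).prod 𝓘(ℝ, ℝ)) (𝓡 4) (foldCollar U j) (n, t)) := by
  intro V V' hVV'
  -- reduce to the kernel
  have hsub : mfderiv ((𝓡 3).prod 𝓘(ℝ, ℝ)) (𝓡 4) (foldCollar U j) (n, t) (V - V') = 0 := by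
    rw [map_sub, sub_eq_zero]
    exact hVV'
  suffices hzero : ∀ W : EuclideanSpace ℝ (Fin 3) × ℝ,
      mfderiv ((𝓡 3).prod 𝓘(ℝ, ℝ)) (𝓡 4) (foldCollar U j) (n, t) W = 0 → W = 0 by
    have := hzero (V - V') hsub
    exact sub_eq_zero.1 this
  rintro ⟨v, τ⟩ hW
  -- the `t`-component vanishes
  have hτ : τ = 0 := by
    have := mfderiv_apply_mfderiv_foldCollar U hj.contMDiff hj0 n ht (v, τ)
    rw [hW, map_zero] at this
    exact this.symm
  subst hτ
  -- the `N`-component vanishes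
  have hv : mfderiv (𝓡 4) (𝓡 4) (fun y => U.fl y t) (j n) (mfderiv (𝓡 3) (𝓡 4) j n v) = 0 := by
    rw [← mfderiv_foldCollar_inl U hj.contMDiff n t v]
    exact hW
  have h1 : mfderiv (𝓡 3) (𝓡 4) j n v = 0 := by
    have h0 : mfderiv (𝓡 4) (𝓡 4) (fun y => U.fl y t) (j n) (mfderiv (𝓡 3) (𝓡 4) j n v) =
        mfderiv (𝓡 4) (𝓡 4) (fun y => U.fl y t) (j n) 0 := by rw [hv, map_zero]
    exact injective_mfderiv_fl U (j n) t h0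
  have h2 : v = 0 := by
    have h0 : mfderiv (𝓡 3) (𝓡 4) j n v = mfderiv (𝓡 3) (𝓡 4) j n 0 := by rw [h1, map_zero]
    exact Literature.Topology.FourManifolds.Manifold.IsImmersionAt.mfderiv_injective
      (hj.isImmersion.isImmersionAt n) (by simp) h0
  rw [h2]
  rfl

/-- **The differential of the collar map is bijective** on `N × (-δ, δ)` (injective between
`4`-dimensional spaces). [cite: MilnorHCobordism1965, proof of Thm. 3.4] -/
theorem bijective_mfderiv_foldCollar [IsManifold (𝓡 3) ∞ N]
    (hj : Manifold.IsSmoothEmbedding (𝓡 3) (𝓡 4) ∞ j)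
    (hj0 : ∀ n, f (j n) = 0) (n : N) {t : ℝ} (ht : t ∈ Ioo (-U.δ) U.δ) :
    Bijective (mfderiv ((𝓡 3).prod 𝓘(ℝ, ℝ)) (𝓡 4) (foldCollar U j) (n, t)) := by
  have hinj := injective_mfderiv_foldCollar U hj hj0 n ht
  refine ⟨hinj, ?_⟩
  let L : (EuclideanSpace ℝ (Fin 3) × ℝ) →ₗ[ℝ] EuclideanSpace ℝ (Fin 4) :=
    (mfderiv ((𝓡 3).prod 𝓘(ℝ, ℝ)) (𝓡 4) (foldCollar U j) (n, t)).toLinearMap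
  have hinj' : Injective L := hinj
  have hdim : Module.finrank ℝ (EuclideanSpace ℝ (Fin 3) × ℝ) =
      Module.finrank ℝ (EuclideanSpace ℝ (Fin 4)) := by
    rw [Module.finrank_prod, finrank_euclideanSpace_fin, finrank_euclideanSpace_fin,
      Module.finrank_self]
  have hsurj : Surjective L :=
    (LinearMap.injective_iff_surjective_of_finrank_eq_finrank hdim).1 hinj'
  exact hsurj

/-! ### The pulled-back form along the zero section -/

omit [T2Space M] [CompactSpace M] [IsManifold (𝓡 4) ∞ M] [TopologicalSpace N]
  [ChartedSpace (EuclideanSpace ℝ (Fin 3)) N] in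
/-- Transport of equality of base points for values of a form on coordinate vectors. [folklore] -/
theorem mform_apply_congr_point' (s : MForm (𝓡 4) M ℝ 2) {p q : M} (hpq : p = q)
    (v : Fin 2 → EuclideanSpace ℝ (Fin 4)) : s p v = s q v := by
  subst hpq
  rfl

variable {s : MForm (𝓡 4) M ℝ 2}

/-- **The collar is kernel-adapted: `ι_{∂t} (c^*ω) = 0` along `N × {0}`** when the unit field lies
in `ker ω` along `j`: `(c^*ω)_{(n,0)}((0,1), W) = ω_{j n}(ξ(j n), dc W) = 0`. This is the
first-order property of the collar of step (S1): the pulled-back form has no `dt`-component on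
the zero section. [cite: CannasdasilvaGuilleminPires2010, proof of Prop. 2.8 (Moser model)] -/
theorem pullback_foldCollar_apply_inr (hj : ContMDiff (𝓡 3) (𝓡 4) ∞ j)
    (hU : ∀ n, ∀ w : TangentSpace (𝓡 4) (j n), s (j n) ![U.ξ (j n), w] = 0) (n : N)
    (W : EuclideanSpace ℝ (Fin 3) × ℝ) :
    (s.pullback ((𝓡 3).prod 𝓘(ℝ, ℝ)) (foldCollar U j)) (n, 0)
      ![((0 : EuclideanSpace ℝ (Fin 3)), (1 : ℝ)), W] = 0 := by
  rw [MForm.pullback_apply]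
  have h1 := mfderiv_foldCollar_inr U hj n 0
  have hvec : (fun i => mfderiv ((𝓡 3).prod 𝓘(ℝ, ℝ)) (𝓡 4) (foldCollar U j) (n, 0)
      ((![((0 : EuclideanSpace ℝ (Fin 3)), (1 : ℝ)), W] :
        Fin 2 → EuclideanSpace ℝ (Fin 3) × ℝ) i)) =
      ![U.ξ (foldCollar U j (n, 0)),
        mfderiv ((𝓡 3).prod 𝓘(ℝ, ℝ)) (𝓡 4) (foldCollar U j) (n, 0) W] := by
    funext i
    fin_cases i
    · exact h1
    · rfl
  refine (congrArg (s (foldCollar U j (n, 0))) hvec).trans ?_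
  rw [mform_apply_congr_point' s (foldCollar_zero U j n)]
  have hξ : (U.ξ (foldCollar U j (n, 0)) : EuclideanSpace ℝ (Fin 4)) = U.ξ (j n) :=
    congrArg (fun x : M => (U.ξ x : EuclideanSpace ℝ (Fin 4))) (foldCollar_zero U j n)
  rw [hξ]
  exact hU n _

/-- **Along the zero section the pulled-back form is `j^*ω` on `N`-vectors**:
`(c^*ω)_{(n,0)}((v,0),(v',0)) = (j^*ω)_n(v, v')` (`c(·, 0) = j`, `Fl_0 = id`).
[cite: CannasdasilvaGuilleminPires2010, proof of Prop. 2.8 (Moser model)] -/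
theorem pullback_foldCollar_apply_inl_inl (hj : ContMDiff (𝓡 3) (𝓡 4) ∞ j) (n : N)
    (v v' : EuclideanSpace ℝ (Fin 3)) :
    (s.pullback ((𝓡 3).prod 𝓘(ℝ, ℝ)) (foldCollar U j)) (n, 0) ![(v, (0 : ℝ)), (v', (0 : ℝ))] =
      (s.pullback (𝓡 3) j) n ![v, v'] := by
  rw [MForm.pullback_apply, MForm.pullback_apply]
  -- `d(Fl_0) = id`
  have hfl0 : (fun y : M => U.fl y 0) = id := by
    funext y
    exact U.fl_zero y
  have hid : ∀ w : EuclideanSpace ℝ (Fin 4),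
      mfderiv (𝓡 4) (𝓡 4) (fun y => U.fl y 0) (j n) w = w := by
    intro w
    rw [hfl0, mfderiv_id]
    rfl
  have hvec : (fun i => mfderiv ((𝓡 3).prod 𝓘(ℝ, ℝ)) (𝓡 4) (foldCollar U j) (n, 0)
      ((![(v, (0 : ℝ)), (v', (0 : ℝ))] : Fin 2 → EuclideanSpace ℝ (Fin 3) × ℝ) i)) =
      ![mfderiv (𝓡 3) (𝓡 4) j n v, mfderiv (𝓡 3) (𝓡 4) j n v'] := by
    funext i
    fin_cases i
    · exact (mfderiv_foldCollar_inl U hj n 0 v).trans (hid _)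
    · exact (mfderiv_foldCollar_inl U hj n 0 v').trans (hid _)
  have hvec' : (fun i => mfderiv (𝓡 3) (𝓡 4) j n ((![v, v'] : Fin 2 → EuclideanSpace ℝ (Fin 3)) i)) =
      ![mfderiv (𝓡 3) (𝓡 4) j n v, mfderiv (𝓡 3) (𝓡 4) j n v'] := by
    funext i
    fin_cases i <;> rfl
  refine (congrArg (s (foldCollar U j (n, 0))) hvec).trans ?_
  rw [mform_apply_congr_point' s (foldCollar_zero U j n)]
  exact (congrArg (s (j n)) hvec').symm

/-! ### The pulled-back form: smooth, closed, non-degenerate off the zero section -/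

/-- The pulled-back form `c^*ω` of a smooth form along the collar map is smooth.
[cite: CannasdasilvaGuilleminPires2010, proof of Prop. 2.8] -/
theorem isSmoothForm_pullback_foldCollar [IsManifold (𝓡 3) ∞ N] (hj : ContMDiff (𝓡 3) (𝓡 4) ∞ j)
    (hs : IsSmoothForm s) :
    IsSmoothForm (s.pullback ((𝓡 3).prod 𝓘(ℝ, ℝ)) (foldCollar U j)) := by
  rw [isSmoothForm_iff_smoothAt]
  intro p
  exact MForm.SmoothAt.pullback
    (Filter.Eventually.of_forall fun z => (contMDiff_foldCollar U hj).contMDiffAt)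
    ((isSmoothForm_iff_smoothAt s).1 hs _)

/-- The pulled-back form `c^*ω` of a smooth closed form along the collar map is closed
(naturality of `d`). [cite: CannasdasilvaGuilleminPires2010, proof of Prop. 2.8] -/
theorem isClosedForm_pullback_foldCollar [IsManifold (𝓡 3) ∞ N] (hj : ContMDiff (𝓡 3) (𝓡 4) ∞ j)
    (hs : IsSmoothForm s) (hc : IsClosedForm s) :
    IsClosedForm (s.pullback ((𝓡 3).prod 𝓘(ℝ, ℝ)) (foldCollar U j)) := by
  funext p
  rw [mextDeriv_pullback_apply
    (Filter.Eventually.of_forall fun z => (contMDiff_foldCollar U hj).contMDiffAt)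
    ((isSmoothForm_iff_smoothAt s).1 hs _)]
  have h0 : mextDeriv s = 0 := hc
  rw [h0, MForm.pullback_zero]

/-- **Off the zero section the pulled-back form is non-degenerate**: for `0 < |t| < δ` the point
`c(n, t)` lies off the fold (`f (c(n,t)) = t ≠ 0`), where `ω` is non-degenerate, and `dc` is
bijective. [cite: CannasdasilvaGuilleminPires2010, §2.1 and proof of Prop. 2.8] -/
theorem pullback_foldCollar_nondegenerate [IsManifold (𝓡 3) ∞ N]
    (hj : Manifold.IsSmoothEmbedding (𝓡 3) (𝓡 4) ∞ j) (hj0 : ∀ n, f (j n) = 0)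
    (hzero : ∀ x, x ∈ fold s → f x = 0) (n : N) {t : ℝ} (ht : t ∈ Ioo (-U.δ) U.δ) (ht0 : t ≠ 0)
    (V : EuclideanSpace ℝ (Fin 3) × ℝ) (hV : V ≠ 0) :
    ∃ W : EuclideanSpace ℝ (Fin 3) × ℝ,
      (s.pullback ((𝓡 3).prod 𝓘(ℝ, ℝ)) (foldCollar U j)) (n, t) ![V, W] ≠ 0 := by
  set L := mfderiv ((𝓡 3).prod 𝓘(ℝ, ℝ)) (𝓡 4) (foldCollar U j) (n, t) with hL
  have hbij := bijective_mfderiv_foldCollar U hj hj0 n ht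
  -- `c(n, t)` is off the fold
  have hoff : foldCollar U j (n, t) ∉ fold s := fun hmem => by
    have := hzero _ hmem
    rw [apply_foldCollar U hj0 n ht] at this
    exact ht0 this
  -- `L V ≠ 0`; pick `w` with `ω (L V, w) ≠ 0` and write `w = L W`
  have hLV : L V ≠ 0 := fun h0 => hV (hbij.1 (h0.trans (map_zero L).symm))
  obtain ⟨w, hw⟩ := forall_ne_zero_of_not_mem_fold hoff hLV
  obtain ⟨W, rfl⟩ := hbij.2 w
  refine ⟨W, ?_⟩
  rw [MForm.pullback_apply]
  have hvec : (fun i => mfderiv ((𝓡 3).prod 𝓘(ℝ, ℝ)) (𝓡 4) (foldCollar U j) (n, t)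
      ((![V, W] : Fin 2 → EuclideanSpace ℝ (Fin 3) × ℝ) i)) = ![L V, L W] := by
    funext i
    fin_cases i <;> rfl
  have e := congrArg (s (foldCollar U j (n, t))) hvec
  exact fun h0 => hw (e.symm.trans h0)

end Differential

end Literature.Geometry.Symplectic

end
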